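import Summits.CriticalPhenomena.CardyFormulaZ2.Theorems.CardySelfDualSegmentUniformMarginalityMirrorDefs
import HarnessLib

/-!
# The self-dual segment is a density family over critical bond-`ℤ²`: the corner-parity (Walsh)
expansion of `P_t(R, δ)`

Support file of line `Sketch` for the crux `UniformMarginality` (stmt-CriticalPhenomena-5472, route
`CardySelfDualSegment`), namespace `…Cruxes.UniformMarginality.HeatFlow`; lead c5.

The corner law of `M_t` is `(½ − t/4 | t/4 ; t/4 | ½ − t/4) = ¼ · (1 + (1 − t) π)` with `π = +1` on a
TIED corner (`E_v = N_v`, splitting bit `d_v` off) and `π = −1` on an untied one.  Hence, on every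
cylinder event, `M_t` has density `∏_v (1 + (1 − t) π_v)` with respect to the fair coin measure
`M_1 = P_{1/2}` (critical bond percolation, `cornerPercolation_one`), and expanding the product gives the
**corner-parity (Walsh–Fourier) expansion of the crossing curve**

  `P_t(R, δ) = Σ_{V ⊆ verts R δ} (1 − t)^{|V|} · a_V`,
  `a_V = E_{1/2}[𝟙_A · ∏_{v ∈ V} π_v] = P_{1/2}(A ∩ {#untied corners in V even}) − P_{1/2}(A ∩ {… odd})`,

`A` the crude crossing event: the crossing curves of the self-dual segment are the generating
polynomials (in `1 − t`) of the corner-diagonal Walsh coefficients of the crossing indicator under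
critical bond-`ℤ²`.  In particular `t ↦ P_t(R,δ)` is a polynomial of degree `≤ #verts`, `P_1 = a_∅`,
`P_0 = Σ_V a_V`, and `∂_t P_t |_{t=1} = −Σ_v a_{{v}}` (the level-one corner-diagonal weight).

Proved here (all exact, every mesh `δ > 0`, every real parameter `s`, `t = projIcc 0 1 s`):
* `prod_cornerWeight_eq` — the weight of one corner in the cylinder formula is `¼ (1 + (1 − t) π_v)`;
* `Pext_eq_sum_cornerParity` — `Pext R δ s = Σ_V (1 − t)^{|V|} · (¼^{n} Σ_{T ∈ A} ∏_{v∈V} π_v(T))`;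
* `quarter_pow_mul_sum_parity_eq_real_sub` — the coefficient is `P_1(A ∩ even_V) − P_1(A ∩ odd_V)` on the
  coin space (`prodBernoulli (cornerParam 1)`);
* `Pext_eq_sum_walsh` — the expansion with probabilistic coefficients (coin space);
* `Pext_eq_sum_walsh_bond` — the same with the coefficients as critical bond-`ℤ²` probabilities of
  `crossEvent R δ ∩ {ω | #{v ∈ V : E_v, N_v in different states} even/odd}`.
No definition is introduced (parities are written as `if (v, 1) ∈ T then −1 else 1` inline).
-/

noncomputable section

namespace Summit.CriticalPhenomena.CardyFormulaZ2.Cruxes.UniformMarginality.HeatFlow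

open MeasureTheory Literature.Probability.Percolation Literature.Probability.LatticeModels
  Literature.Probability.RandomPlanarGeometry
open scoped Classical

/-! ## §1 The weight of one corner -/

/-- The fair coin coordinate of `cornerParam t` is `1/2` as a real number. -/
theorem coe_cornerParam_apply_zero (t : unitInterval) (v : Site 2) :
    ((cornerParam t (v, 0) : unitInterval) : ℝ) = 1 / 2 := by
  rw [cornerParam_apply_zero, coe_half]

/-- **The weight of one corner.** In the cylinder formula for `prodBernoulli (cornerParam t)`, the
product of the weights of the coin `(v,0)` and the splitting bit `(v,1)` of a vertex `v` at a coin
pattern `T` is `¼ · (1 + (1 − t) · π_v(T))`, `π_v(T) = −1` if `(v,1) ∈ T` (untied corner) and `+1`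
otherwise: the corner law `(½ − t/4 | t/4 ; t/4 | ½ − t/4)`. -/
theorem prod_cornerWeight_eq (t : unitInterval) (v : Site 2) (T : Finset (Site 2 × Fin 2)) :
    ∏ j : Fin 2, (if (v, j) ∈ T then ((cornerParam t (v, j) : unitInterval) : ℝ)
        else 1 - ((cornerParam t (v, j) : unitInterval) : ℝ)) =
      (1 / 4 : ℝ) * (1 + (1 - (t : ℝ)) * (if (v, (1 : Fin 2)) ∈ T then (-1 : ℝ) else 1)) := by
  rw [Fin.prod_univ_two, coe_cornerParam_apply_zero, coe_cornerParam_apply_one]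
  by_cases h0 : (v, (0 : Fin 2)) ∈ T <;> by_cases h1 : (v, (1 : Fin 2)) ∈ T <;>
    simp only [h0, h1, if_true, if_false] <;> ring

/-- **The weight of a coin pattern** over the window `K ×ˢ univ`: `(1/4)^{#K} ∏_{v ∈ K} (1 + (1 − t) π_v(T))`. -/
theorem prod_coinWeight_eq (t : unitInterval) (K : Finset (Site 2)) (T : Finset (Site 2 × Fin 2)) :
    ∏ i ∈ K ×ˢ (Finset.univ : Finset (Fin 2)),
        (if i ∈ T then ((cornerParam t i : unitInterval) : ℝ) else 1 - ((cornerParam t i : unitInterval) : ℝ)) =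
      (1 / 4 : ℝ) ^ K.card * ∏ v ∈ K, (1 + (1 - (t : ℝ)) * (if (v, (1 : Fin 2)) ∈ T then (-1 : ℝ) else 1)) := by
  rw [Finset.prod_product]
  simp_rw [prod_cornerWeight_eq]
  rw [Finset.prod_mul_distrib, Finset.prod_const]

/-- Expanding `∏_{v ∈ K} (1 + (1 − t) π_v)` over the subsets of `K`:
`Σ_{V ⊆ K} (1 − t)^{|V|} ∏_{v ∈ V} π_v`. -/
theorem prod_one_add_parity_eq_sum (c : ℝ) (K : Finset (Site 2)) (π : Site 2 → ℝ) :
    ∏ v ∈ K, (1 + c * π v) = ∑ V ∈ K.powerset, c ^ V.card * ∏ v ∈ V, π v := by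
  rw [Finset.prod_one_add]
  refine Finset.sum_congr rfl fun V _ => ?_
  rw [Finset.prod_mul_distrib, Finset.prod_const]

/-! ## §2 The corner-parity expansion of `Pext` -/

/-- **Corner-parity expansion of the crossing curve (combinatorial form).** For `δ > 0` and every
real `s`, with `t = projIcc 0 1 s`, `K = verts R δ` and `A` the coin-space crude crossing event,
`Pext R δ s = Σ_{V ⊆ K} (1 − t)^{|V|} · ((1/4)^{#K} Σ_{T ⊆ K × {0,1}, T ∈ A} ∏_{v ∈ V} π_v(T))`,
`π_v(T) = −1` if the splitting bit `(v,1)` is on in `T` and `+1` otherwise. -/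
theorem Pext_eq_sum_cornerParity (R : ConformalRectangle) {δ : ℝ} (hδ : 0 < δ) (s : ℝ) :
    Pext R δ s = ∑ V ∈ (verts_finite R hδ).toFinset.powerset,
      (1 - ((Set.projIcc (0 : ℝ) 1 zero_le_one s : unitInterval) : ℝ)) ^ V.card *
        ((1 / 4 : ℝ) ^ (verts_finite R hδ).toFinset.card *
          ∑ T ∈ ((verts_finite R hδ).toFinset ×ˢ (Finset.univ : Finset (Fin 2))).powerset,
            if (↑T : Set (Site 2 × Fin 2)) ∈ coinEvent R δ then
              ∏ v ∈ V, (if (v, (1 : Fin 2)) ∈ T then (-1 : ℝ) else 1) else 0) := by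
  set K := (verts_finite R hδ).toFinset with hK
  set t : unitInterval := Set.projIcc (0 : ℝ) 1 zero_le_one s with ht
  rw [Pext_eq_sum R hδ s]
  -- rewrite each cylinder weight through the corner weights and expand the product
  have hterm : ∀ T ∈ (K ×ˢ (Finset.univ : Finset (Fin 2))).powerset,
      (if (↑T : Set (Site 2 × Fin 2)) ∈ coinEvent R δ then
          ∏ i ∈ K ×ˢ (Finset.univ : Finset (Fin 2)),
            (if i ∈ T then ((cornerParam t i : unitInterval) : ℝ) else 1 - ((cornerParam t i : unitInterval) : ℝ))
        else 0) =
      ∑ V ∈ K.powerset, (if (↑T : Set (Site 2 × Fin 2)) ∈ coinEvent R δ then (1 : ℝ) else 0) *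
        ((1 - (t : ℝ)) ^ V.card * ((1 / 4 : ℝ) ^ K.card *
          ∏ v ∈ V, (if (v, (1 : Fin 2)) ∈ T then (-1 : ℝ) else 1))) := by
    intro T _
    by_cases hT : (↑T : Set (Site 2 × Fin 2)) ∈ coinEvent R δ
    · simp only [hT, if_true, one_mul]
      rw [prod_coinWeight_eq, prod_one_add_parity_eq_sum, Finset.mul_sum]
      refine Finset.sum_congr rfl fun V _ => ?_
      ring
    · simp only [hT, if_false, zero_mul, Finset.sum_const_zero]
  rw [Finset.sum_congr rfl hterm, Finset.sum_comm]
  refine Finset.sum_congr rfl fun V _ => ?_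
  rw [Finset.mul_sum, Finset.mul_sum]
  refine Finset.sum_congr rfl fun T _ => ?_
  by_cases hT : (↑T : Set (Site 2 × Fin 2)) ∈ coinEvent R δ
  · simp only [hT, if_true, one_mul]
  · simp only [hT, if_false, zero_mul, mul_zero]

/-! ## §3 The coefficients are fair-coin correlations -/

/-- The product of the corner parities over `V` is `+1` or `−1` according to the parity of the
number of untied corners (`(v,1) ∈ T`) in `V`. -/
theorem prod_parity_eq_ite (V : Finset (Site 2)) (T : Finset (Site 2 × Fin 2)) :
    ∏ v ∈ V, (if (v, (1 : Fin 2)) ∈ T then (-1 : ℝ) else 1) =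
      if Even (V.filter fun v => (v, (1 : Fin 2)) ∈ T).card then (1 : ℝ) else -1 := by
  rw [Finset.prod_ite, Finset.prod_const_one, mul_one, Finset.prod_const]
  split_ifs with h
  · exact h.neg_one_pow
  · exact (Nat.not_even_iff_odd.1 h).neg_one_pow

/-- At `t = 1` every coordinate of `cornerParam` is `1/2` as a real number. -/
theorem coe_cornerParam_one_apply (i : Site 2 × Fin 2) :
    ((cornerParam 1 i : unitInterval) : ℝ) = 1 / 2 := by
  rw [cornerParam_one, coe_half]

/-- At `t = 1` every cylinder over the window `K ×ˢ univ` has weight `(1/4)^{#K}`. -/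
theorem prod_coinWeight_one_eq (K : Finset (Site 2)) (T : Finset (Site 2 × Fin 2)) :
    ∏ i ∈ K ×ˢ (Finset.univ : Finset (Fin 2)),
        (if i ∈ T then ((cornerParam 1 i : unitInterval) : ℝ) else 1 - ((cornerParam 1 i : unitInterval) : ℝ)) =
      (1 / 4 : ℝ) ^ K.card := by
  have h : ∀ i ∈ K ×ˢ (Finset.univ : Finset (Fin 2)),
      (if i ∈ T then ((cornerParam 1 i : unitInterval) : ℝ) else 1 - ((cornerParam 1 i : unitInterval) : ℝ)) =
        1 / 2 := by
    intro i _
    rw [coe_cornerParam_one_apply]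
    split_ifs <;> norm_num
  rw [Finset.prod_congr rfl h, Finset.prod_const, Finset.card_product, Finset.card_univ,
    Fintype.card_fin, mul_comm, pow_mul]
  norm_num

/-- The parity event of the untied corners of `V ⊆ K` is determined by the window `K ×ˢ univ`. -/
theorem determinedBy_parity {K V : Finset (Site 2)} (hV : V ⊆ K) (P : ℕ → Prop) :
    DeterminedBy {S : Set (Site 2 × Fin 2) | P (V.filter fun v => (v, (1 : Fin 2)) ∈ S).card}
      ↑(K ×ˢ (Finset.univ : Finset (Fin 2))) := by
  rw [determinedBy_iff]
  intro S S' hSS'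
  have hfilter : (V.filter fun v => (v, (1 : Fin 2)) ∈ S) = V.filter fun v => (v, (1 : Fin 2)) ∈ S' := by
    refine Finset.filter_congr fun v hv => ?_
    have hmem : (v, (1 : Fin 2)) ∈ (↑(K ×ˢ (Finset.univ : Finset (Fin 2))) : Set (Site 2 × Fin 2)) := by
      rw [Finset.coe_product, Finset.coe_univ]
      exact ⟨hV hv, Set.mem_univ _⟩
    constructor
    · intro h; exact ((Set.ext_iff.1 hSS' (v, 1)).1 ⟨h, hmem⟩).1
    · intro h; exact ((Set.ext_iff.1 hSS' (v, 1)).2 ⟨h, hmem⟩).1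
  simp only [Set.mem_setOf_eq, hfilter]

/-- **The corner-parity coefficient is a fair-coin correlation.** For `V ⊆ K = verts R δ`,
`(1/4)^{#K} Σ_{T ∈ A} ∏_{v ∈ V} π_v(T) = P_1(A ∩ {#untied in V even}) − P_1(A ∩ {#untied in V odd})`
(`= E_1[𝟙_A ∏_{v∈V} π_v]`), `P_1 = prodBernoulli (cornerParam 1)` the fair coin measure. -/
theorem quarter_pow_mul_sum_parity_eq_real_sub (R : ConformalRectangle) {δ : ℝ} (hδ : 0 < δ)
    {V : Finset (Site 2)} (hV : V ⊆ (verts_finite R hδ).toFinset) :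
    (1 / 4 : ℝ) ^ (verts_finite R hδ).toFinset.card *
        ∑ T ∈ ((verts_finite R hδ).toFinset ×ˢ (Finset.univ : Finset (Fin 2))).powerset,
          (if (↑T : Set (Site 2 × Fin 2)) ∈ coinEvent R δ then
            ∏ v ∈ V, (if (v, (1 : Fin 2)) ∈ T then (-1 : ℝ) else 1) else 0) =
      (prodBernoulli (cornerParam 1)).real
          (coinEvent R δ ∩ {S | Even (V.filter fun v => (v, (1 : Fin 2)) ∈ S).card}) -
        (prodBernoulli (cornerParam 1)).real
          (coinEvent R δ ∩ {S | ¬ Even (V.filter fun v => (v, (1 : Fin 2)) ∈ S).card}) := by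
  set K := (verts_finite R hδ).toFinset with hK
  have hdetE : DeterminedBy (coinEvent R δ ∩ {S | Even (V.filter fun v => (v, (1 : Fin 2)) ∈ S).card})
      ↑(K ×ˢ (Finset.univ : Finset (Fin 2))) :=
    (determinedBy_coinEvent R hδ).inter (determinedBy_parity hV Even)
  have hdetO : DeterminedBy (coinEvent R δ ∩ {S | ¬ Even (V.filter fun v => (v, (1 : Fin 2)) ∈ S).card})
      ↑(K ×ˢ (Finset.univ : Finset (Fin 2))) :=
    (determinedBy_coinEvent R hδ).inter (determinedBy_parity hV fun n => ¬ Even n)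
  rw [RussoPath.prodBernoulli_real_eq_sum_powerset hdetE (cornerParam 1),
    RussoPath.prodBernoulli_real_eq_sum_powerset hdetO (cornerParam 1), ← Finset.sum_sub_distrib,
    Finset.mul_sum]
  refine Finset.sum_congr rfl fun T _ => ?_
  rw [prod_coinWeight_one_eq, prod_parity_eq_ite]
  simp only [Set.mem_inter_iff, Set.mem_setOf_eq, Finset.mem_coe]
  by_cases hT : (↑T : Set (Site 2 × Fin 2)) ∈ coinEvent R δ
  · by_cases hE : Even (V.filter fun v => (v, (1 : Fin 2)) ∈ T).card
    · simp only [hT, hE, if_true, and_self, not_true_eq_false, and_false, if_false, sub_zero, mul_one]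
    · simp only [hT, hE, if_true, if_false, and_false, not_false_eq_true, and_self, zero_sub, mul_neg,
        mul_one]
  · simp only [hT, if_false, false_and, mul_zero, sub_zero]

/-- **Corner-parity (Walsh) expansion of the crossing curve, coin-space form.** For `δ > 0` and every
real `s`, with `t = projIcc 0 1 s`:
`P_t(R,δ) = Σ_{V ⊆ verts R δ} (1 − t)^{|V|} · (P_1(A ∩ {#untied corners in V even}) − P_1(A ∩ {… odd}))`,
`P_1 = prodBernoulli (cornerParam 1)` the fair coin measure and `A = coinEvent R δ`: on cylinder events
`M_t` has density `∏_v (1 + (1 − t) π_v)` with respect to `M_1`. -/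
theorem Pext_eq_sum_walsh (R : ConformalRectangle) {δ : ℝ} (hδ : 0 < δ) (s : ℝ) :
    Pext R δ s = ∑ V ∈ (verts_finite R hδ).toFinset.powerset,
      (1 - ((Set.projIcc (0 : ℝ) 1 zero_le_one s : unitInterval) : ℝ)) ^ V.card *
        ((prodBernoulli (cornerParam 1)).real
            (coinEvent R δ ∩ {S | Even (V.filter fun v => (v, (1 : Fin 2)) ∈ S).card}) -
          (prodBernoulli (cornerParam 1)).real
            (coinEvent R δ ∩ {S | ¬ Even (V.filter fun v => (v, (1 : Fin 2)) ∈ S).card})) := by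
  rw [Pext_eq_sum_cornerParity R hδ s]
  refine Finset.sum_congr rfl fun V hV => ?_
  rw [quarter_pow_mul_sum_parity_eq_real_sub R hδ (Finset.mem_powerset.1 hV)]

/-! ## §4 The coefficients as critical bond-`ℤ²` probabilities -/

/-- The east edge of `v` is open in the corner configuration of `S` iff the coin `(v,0)` is on. -/
theorem eastEdge_mem_cornerConfig_iff (S : Set (Site 2 × Fin 2)) (v : Site 2) :
    eastEdge v ∈ cornerConfig S ↔ (v, (0 : Fin 2)) ∈ S := by
  rw [eastEdge_eq_cornerEdge, cornerEdge_mem_cornerConfig_iff]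
  rfl

/-- The north edge of `v` is open in the corner configuration of `S` iff the coin and the splitting
bit of `v` disagree. -/
theorem northEdge_mem_cornerConfig_iff (S : Set (Site 2 × Fin 2)) (v : Site 2) :
    northEdge v ∈ cornerConfig S ↔ ((v, (0 : Fin 2)) ∈ S ↔ (v, (1 : Fin 2)) ∉ S) := by
  rw [northEdge_eq_cornerEdge, cornerEdge_mem_cornerConfig_iff]
  rfl

/-- A corner is UNTIED in the corner configuration (east and north edges in different states) iff its
splitting bit is on. -/
theorem not_eastEdge_iff_northEdge_iff (S : Set (Site 2 × Fin 2)) (v : Site 2) :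
    ¬ (eastEdge v ∈ cornerConfig S ↔ northEdge v ∈ cornerConfig S) ↔ (v, (1 : Fin 2)) ∈ S := by
  rw [eastEdge_mem_cornerConfig_iff, northEdge_mem_cornerConfig_iff]
  tauto

/-- The untied-corner parity events pull back along the corner map to the splitting-bit parity
events. -/
theorem preimage_cornerConfig_parity (V : Finset (Site 2)) (P : ℕ → Prop) :
    cornerConfig ⁻¹' {ω : BondConfig (Site 2) |
        P (V.filter fun v => ¬ (eastEdge v ∈ ω ↔ northEdge v ∈ ω)).card} =
      {S | P (V.filter fun v => (v, (1 : Fin 2)) ∈ S).card} := by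
  ext S
  simp only [Set.mem_preimage, Set.mem_setOf_eq]
  rw [Finset.filter_congr fun v _ => not_eastEdge_iff_northEdge_iff S v]

/-- The untied-corner parity event is determined by the finitely many edges of the corners of `V`,
hence measurable. -/
theorem measurableSet_parity (V : Finset (Site 2)) (P : ℕ → Prop) :
    MeasurableSet {ω : BondConfig (Site 2) |
      P (V.filter fun v => ¬ (eastEdge v ∈ ω ↔ northEdge v ∈ ω)).card} := by
  have hdet : DeterminedBy {ω : BondConfig (Site 2) |
      P (V.filter fun v => ¬ (eastEdge v ∈ ω ↔ northEdge v ∈ ω)).card}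
      ↑(V.image eastEdge ∪ V.image northEdge) := by
    rw [determinedBy_iff]
    intro ω ω' hωω'
    have hagree : ∀ e ∈ (↑(V.image eastEdge ∪ V.image northEdge) : Set (Sym2 (Site 2))),
        e ∈ ω ↔ e ∈ ω' := fun e he =>
      ⟨fun h => ((Set.ext_iff.1 hωω' e).1 ⟨h, he⟩).1, fun h => ((Set.ext_iff.1 hωω' e).2 ⟨h, he⟩).1⟩
    have hfilter : (V.filter fun v => ¬ (eastEdge v ∈ ω ↔ northEdge v ∈ ω)) =
        V.filter fun v => ¬ (eastEdge v ∈ ω' ↔ northEdge v ∈ ω') := by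
      refine Finset.filter_congr fun v hv => ?_
      have hE := hagree (eastEdge v) (by
        rw [Finset.coe_union, Finset.coe_image, Finset.coe_image]
        exact Or.inl ⟨v, hv, rfl⟩)
      have hN := hagree (northEdge v) (by
        rw [Finset.coe_union, Finset.coe_image, Finset.coe_image]
        exact Or.inr ⟨v, hv, rfl⟩)
      rw [hE, hN]
    simp only [Set.mem_setOf_eq, hfilter]
  exact hdet.measurableSet_of_finset

/-- **The corner-parity coefficients are critical bond-`ℤ²` probabilities**: for every `V`,
`P_1(A ∩ {#untied in V has parity P}) = P_{1/2}(crossEvent R δ ∩ {ω | #{v ∈ V : E_v, N_v differ in ω} has parity P})`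
(`cornerPercolation 1 = bondPercolation (zdGraph 2) half`). -/
theorem prodBernoulli_one_real_coinEvent_inter_parity (R : ConformalRectangle) (δ : ℝ)
    (V : Finset (Site 2)) (P : ℕ → Prop) :
    (prodBernoulli (cornerParam 1)).real
        (coinEvent R δ ∩ {S | P (V.filter fun v => (v, (1 : Fin 2)) ∈ S).card}) =
      (bondPercolation (zdGraph 2) half).real
        (crossEvent R δ ∩ {ω | P (V.filter fun v => ¬ (eastEdge v ∈ ω ↔ northEdge v ∈ ω)).card}) := by
  rw [← cornerPercolation_one,
    cornerPercolation_real_apply 1 ((measurableSet_crossEvent R δ).inter (measurableSet_parity V P)),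
    Set.preimage_inter, preimage_cornerConfig_parity, coinEvent_eq_preimage]

/-- **Corner-parity (Walsh) expansion of the crossing curve over critical bond-`ℤ²`.** For `δ > 0` and
every real `s`, with `t = projIcc 0 1 s` and `A = crossEvent R δ`:
`P_t(R,δ) = Σ_{V ⊆ verts R δ} (1 − t)^{|V|} · (P_{1/2}(A ∩ {#untied corners of V even}) − P_{1/2}(A ∩ {… odd}))`,
a corner `v` being untied in `ω` when its east and north edges are in different states.  So the
crossing curves of the self-dual segment are the generating polynomials, in `1 − t`, of the
corner-diagonal Walsh–Fourier coefficients `a_V = E_{1/2}[𝟙_A ∏_{v∈V} π_v]` of the crude crossing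
indicator under critical bond percolation; `P_1(R,δ) = a_∅`, `P_0(R,δ) = Σ_V a_V`. -/
theorem Pext_eq_sum_walsh_bond : ∀ (R : ConformalRectangle) (δ : ℝ) (hδ : 0 < δ) (s : ℝ), Pext R δ s = ∑ V ∈ (verts_finite R hδ).toFinset.powerset, (1 - ((Set.projIcc (0 : ℝ) 1 zero_le_one s : unitInterval) : ℝ)) ^ V.card * ((bondPercolation (zdGraph 2) half).real (crossEvent R δ ∩ {ω | Even (V.filter fun v => ¬ (eastEdge v ∈ ω ↔ northEdge v ∈ ω)).card}) - (bondPercolation (zdGraph 2) half).real (crossEvent R δ ∩ {ω | ¬ Even (V.filter fun v => ¬ (eastEdge v ∈ ω ↔ northEdge v ∈ ω)).card})) := by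
  intro R δ hδ s
  rw [Pext_eq_sum_walsh R hδ s]
  refine Finset.sum_congr rfl fun V _ => ?_
  rw [prodBernoulli_one_real_coinEvent_inter_parity R δ V Even,
    prodBernoulli_one_real_coinEvent_inter_parity R δ V fun n => ¬ Even n]

end Summit.CriticalPhenomena.CardyFormulaZ2.Cruxes.UniformMarginality.HeatFlow

end
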